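import Literature.NumberTheory.NumberFields.CubicFieldDedekindKummer
import Literature.NumberTheory.ComplexMultiplication.DadeTausskyZassenhausCubicOrders
import Mathlib.NumberTheory.NumberField.Units.DirichletTheorem
import Mathlib.GroupTheory.Archimedean
import HarnessLib

/-!
# The units of `ℤ[β]`, `β³ + 2β² + 2β + 2 = 0`, modulo squares, and `[L₄]_ε ≠ [Λ₄]_ε`
# (Hertling–Larabi 2026b §8: «`|G([Λ₄]_ε)| = ¼ · 32/4 = 2`», `L₄ = ⟨2, 2β, 2β² + 1⟩_ℤ`)

[topic NumberTheory/ComplexMultiplication] Lane `lit-hodgefound` (Track 2 foundations library), seat p19 generation 43,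
row g43-#2.  Sequel of `DadeTausskyZassenhausCubicOrders` (p19 g41-#4/#5: the orders `Λ₁ ⊃ Λ₂ ⊃ Λ₃ ⊃ Λ₄ = ℤ[2β]`,
the lattices `L₃`, `L₄`, `(β+1)·(−(β²+β+1)) = 1`, the membership criteria `mem_spanL₄_iff` …, all REUSED) and the
number-theoretic input of part II of `LinearAlgebra/Matrix/GL3ZDadeTausskyZassenhausSixClasses` (p19 g43-#1): that
the last two of HL's six matrices, `M_{Λ₄}` and `M_{L₄}`, are not `GL₃(ℤ)`-conjugate is the statement that the
invertible `Λ₄`-ideal `L₄` is not principal, `[L₄]_ε ≠ [Λ₄]_ε`.  HL obtain `|G([Λ₄]_ε)| = 2` from their class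
number formula (Thm. 5.12 (e)) fed with three facts CITED from [LMFDB23] («`Λ_max = ℤ[γ]`», «`Λ_max^{unit} =
{±γ^l}`», class number `1`).  Here the inequality `[L₄]_ε ≠ [Λ₄]_ε` is PROVED from first principles, replacing the
LMFDB unit group by what Dirichlet's unit theorem (Mathlib) gives for the ORDER `ℤ[β]` together with one residue
computation: (§1) `K = ℚ(β)` has one real place, unit rank `1`; (§2) the units of `ℤ[β]` are `±η₀^ℤ`; (§3) `±(β+1)`
are non-squares in `ℤ[β]` (`ℤ[β] → 𝔽₁₃`, `β ↦ 10`); (§4) hence every unit of `ℤ[β]` is `±(β+1)^j η²`, `j ∈ {0,1}`;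
(§5) HL's count modulo `C₄ = 4Λ₁` then becomes a finite check (`decide` over `ℤ/4`): no unit of `ℤ[β]` lies in
`L₄`; (§6) so `c·Λ₄ ≠ L₄` for every `c`, and the cubic form `det P` of the conjugacy problem never takes the values
`±1`.  Uses the tree's explicit-cubic-field kit `NumberTheory/NumberFields/CubicFieldExplicit` … `CubicFieldDedekindKummer`
(`MonicCubic.poly`, `pb`, `thetaInt`, `minpoly_thetaInt`, `irreducible_polyQ_of_no_root`) BY NAME.
THEOREMS ONLY: no definition, no instance, no notation, no named fact (D-0026, net Literature debt `0`), no `sorry`.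

## Source, VERBATIM — C. Hertling, K. Larabi, *Conjugacy classes of regular integer matrices*, arXiv:2602.15748
(2026) [HertlingLarabi2026b], held `paper:arxiv-2602.15748`, §8 «An irreducible rank 3 case», chunks p0024–p0026

«First, we cite (and use without own proof) some facts which [LMFDB23] states on the algebraic number field
`A := ℚ[α]` and its maximal order `Λ_max` of algebraic integers: `A = ℚ[γ]` where `γ` is a zero of `t³ − t² + t + 1`,
`Λ_max = ℤ[γ] = ⟨1, γ, γ²⟩_ℤ`, `Λ_max^{unit} = {±γ^l | l ∈ ℤ}`, `|G([Λ_max]_ε)| = (class number of A) = 1`.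
Define `β := γ − 1`. Then `0 = β³ + 2β² + 2β + 2`, `α = 2β`, `Λ₁ := Λ_max = ℤ[β]`, `Λ_max^{unit} = {±(β+1)^l | l ∈ ℤ}`,
`Λ₄ = ℤ[2β] = ⟨1, 2β, 4β²⟩_ℤ`. […] `|G([Λ₄]_ε)| = ¼ · 32/4 = 2`.  We want to find an invertible full lattice `L₄`
with `G([Λ₄]_ε) = {[Λ₄]_ε, [L₄]_ε}`. By Theorem 5.12 (c)+(d) we can choose `L₄ = C₄ + aΛ₁` where `a ∈ Λ₁` with
`a + C₄ ∈ (Λ₁/C₄)^{unit} − (the subgroup generated by (Λ₄/C₄)^{unit} and the image of Λ₁^{unit})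
= (Λ₁/C₄)^{unit} − (Λ₄/C₄)^{unit}·{(β+1)^l | l ∈ {0,1,2,3}} = (32 elements) − (16 elements)`.  `a := 1 + 2β²` works
and gives `L₄ = C₄ + aΛ₄ = ⟨4, 4β, 4β²⟩_ℤ + ⟨1 + 2β², (1 + 2β²)2β, (1 + 2β²)4β²⟩_ℤ = ⟨2, 2β, 2β² + 1⟩_ℤ`. (8.2) […]
`M_{Λ₄} = (0 0 −16; 1 0 −8; 0 1 −4)`, `M_{L₄} = (0 −1 −2; 2 0 −3; 0 2 −4)`.»

## What is proved (`K` a number field of degree `3`, `θ ∈ K` with `θ³ + 2θ² + 2θ + 2 = 0`, `Λ₁ = ⟨1, θ, θ²⟩_ℤ`;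
a unit of `Λ₁` is spelled `c ∈ Λ₁ ∧ x ∈ Λ₁ ∧ c·x = 1`)

* §0 `irreducible_polyQ_two_two_two`, `theta_rel_two`, `linearIndependent_one_theta_sq`.
* §1 **`units_rank_eq_one`**: `NumberField.Units.rank K = 1` (the cubic is strictly increasing, so at most one real
  embedding — `PowerBasis.algHom_ext` —, and `r₁ + 2r₂ = 3`).
* §2 **`exists_generator_units_span₁`**: `∃ η₀` (a unit of `Λ₁`) with every unit of `Λ₁` equal to `±η₀^m`
  (coordinates on Mathlib's `basisModTorsion`, torsion `±1` in odd degree, `Int.subgroup_cyclic`).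
* §3 **`sq_ne_theta_add_one`**: `η² ≠ θ + 1` and `η² ≠ −(θ + 1)` for `η ∈ Λ₁`.
* §4 **`unit_eq_sign_mul_pow_mul_sq`**: every unit of `Λ₁` is `s·(θ+1)^j·η²`, `s = ±1`, `j ≤ 1`, `η` a unit.
* §5 `coords_sq`, `coords_theta_add_one_mul`, `coords_mul`, `odd_of_unit`, and **`not_mem_spanL₄_of_unit`**: no unit
  of `Λ₁` lies in `L₄ = ⟨2, 2θ, 2θ² + 1⟩_ℤ`.
* §6 **`smul_span₄_ne_spanL₄`**: `c • Λ₄ ≠ L₄` for every `c ∈ K` (`[L₄]_ε ≠ [Λ₄]_ε`: `L₄` is a non-principal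
  invertible `Λ₄`-ideal); `basisL₄_mul_adj_eq_det` (the identity `c·x̃ = det P` for `P = (w | M_{L₄}w | M_{L₄}²w)`,
  `c = 𝓑_{L₄}·w`), `det_form_ne_of_root` and the unconditional Diophantine statement **`det_form_ne`**:
  `8p³ − 16p²q + 12p²r + 16pq² − 26pr² − 16q³ + 40q²r − 28qr² + 17r³ ≠ ±1` for all `p, q, r ∈ ℤ`
  (in `K = ℚ[t]/(t³ + 2t² + 2t + 2)`).

## References
* [HertlingLarabi2026b] C. Hertling, K. Larabi, *Conjugacy classes of regular integer matrices*, arXiv:2602.15748, §8.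
* [Marcus2018] D. A. Marcus, *Number Fields*, 2nd ed. (2018), Ch. 5, Thm. 38 (Dirichlet's unit theorem) — through
  Mathlib `NumberField.Units.basisModTorsion`, `torsion_eq_one_or_neg_one_of_odd_finrank`.
* [DTZ62] E. C. Dade, O. Taussky, H. Zassenhaus, *On the theory of orders …*, Math. Ann. 148 (1962) 31–64 (the example,
  as reported by HL §8; source not held).
-/

noncomputable section

open Polynomial Module NumberField Submodule

namespace Literature.NumberTheory.ComplexMultiplication.FiniteQAlgebraLattice.DTZCubic

open Literature.NumberTheory.NumberFields

variable {K : Type*} [Field K] [NumberField K] {θ : K}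

/-! ## §0 The cubic field `K = ℚ(θ)`, `θ³ + 2θ² + 2θ + 2 = 0` -/

/-- `t³ + 2t² + 2t + 2` is irreducible over `ℚ` (it has no root modulo `3`).
[cite: HertlingLarabi2026b, §8 («`α` a zero of the irreducible polynomial `t³ + 4t² + 8t + 16`», `α = 2β`), chunk p0024] -/
theorem irreducible_polyQ_two_two_two : Irreducible (MonicCubic.polyQ 2 2 2) := by
  have hnr : ∀ r : ZMod 3, r ^ 3 + ((2 : ℤ) : ZMod 3) * r ^ 2 + ((2 : ℤ) : ZMod 3) * r + ((2 : ℤ) : ZMod 3) ≠ 0 := by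
    decide
  haveI : Fact (Nat.Prime 3) := ⟨Nat.prime_three⟩
  exact MonicCubic.irreducible_polyQ_of_no_root 3 hnr

omit [NumberField K] in
/-- The cubic relation `θ³ + 2θ² + 2θ + 2 = 0` from `aeval θ (X³ + 2X² + 2X + 2) = 0`.
[cite: HertlingLarabi2026b, §8 («`0 = β³ + 2β² + 2β + 2`»), chunk p0024] -/
theorem theta_rel_two (hθ : aeval θ (MonicCubic.poly 2 2 2) = 0) : θ ^ 3 + 2 * θ ^ 2 + 2 * θ + 2 = 0 := by
  have h := MonicCubic.theta_rel hθ
  push_cast at h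
  exact h

/-- `1, θ, θ²` are `ℤ`-linearly independent in the cubic field `K = ℚ(θ)`.
[cite: HertlingLarabi2026b, §8 («`Λ₁ = ⟨1, β, β²⟩_ℤ`»), chunk p0024] -/
theorem linearIndependent_one_theta_sq (hθ : aeval θ (MonicCubic.poly 2 2 2) = 0) (h3 : finrank ℚ K = 3) :
    LinearIndependent ℤ ![(1 : K), θ, θ ^ 2] := by
  have hb := (MonicCubic.basis irreducible_polyQ_two_two_two hθ h3).linearIndependent
  have hfun : ⇑(MonicCubic.basis irreducible_polyQ_two_two_two hθ h3) = ![(1 : K), θ, θ ^ 2] := by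
    funext i
    rw [MonicCubic.basis_apply]
    fin_cases i <;> simp
  rw [hfun] at hb
  exact hb.restrict_scalars (fun a b h => by simpa using h)

omit [NumberField K] in
/-- Coefficient comparison on `1, θ, θ²`. [folklore] -/
private theorem coords_eq (hli : LinearIndependent ℤ ![(1 : K), θ, θ ^ 2]) {a b c a' b' c' : ℤ}
    (h : (a : K) + b * θ + c * θ ^ 2 = (a' : K) + b' * θ + c' * θ ^ 2) : a = a' ∧ b = b' ∧ c = c' := by
  have H := Fintype.linearIndependent_iff.1 hli ![a - a', b - b', c - c'] (by
    simp only [Fin.sum_univ_three, zsmul_eq_mul]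
    simp only [Matrix.cons_val_zero, Matrix.cons_val_one, Matrix.cons_val]
    push_cast
    linear_combination h)
  refine ⟨?_, ?_, ?_⟩
  · have := H 0; simp at this; omega
  · have := H 1; simp at this; omega
  · have := H 2; simp at this; omega

/-! ## §1 One real place: the unit rank of `K` is `1` -/

/-- `t³ + 2t² + 2t + 2` is strictly increasing on `ℝ` (`12·(x² + xy + y² + 2x + 2y + 2) = 3(2x + y + 2)² + (3y + 2)²
+ 8 > 0`), so it has at most one real root. [folklore] -/
private theorem real_root_unique {x y : ℝ} (hx : x ^ 3 + 2 * x ^ 2 + 2 * x + 2 = 0)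
    (hy : y ^ 3 + 2 * y ^ 2 + 2 * y + 2 = 0) : x = y := by
  by_contra hne
  have hq : 0 < x ^ 2 + x * y + y ^ 2 + 2 * x + 2 * y + 2 := by
    nlinarith [sq_nonneg (2 * x + y + 2), sq_nonneg (3 * y + 2)]
  have hprod : (x - y) * (x ^ 2 + x * y + y ^ 2 + 2 * x + 2 * y + 2) = 0 := by linear_combination hx - hy
  rcases mul_eq_zero.1 hprod with h | h
  · exact hne (sub_eq_zero.1 h)
  · exact absurd h hq.ne'

/-- **`K = ℚ(θ)` has exactly one real place and one complex place; its unit rank is `1`** (the cubic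
`t³ + 2t² + 2t + 2` has exactly one real root, and a real embedding is determined by the image of `θ`).  HL cite
`Λ_max^{unit} = {±(β+1)^l | l ∈ ℤ}` from [LMFDB23]; only the RANK is used below.
[cite: HertlingLarabi2026b, §8 («`Λ_max^{unit} = {±(β+1)^l | l ∈ ℤ}`»), chunk p0024] -/
theorem units_rank_eq_one (hθ : aeval θ (MonicCubic.poly 2 2 2) = 0) (h3 : finrank ℚ K = 3) :
    NumberField.Units.rank K = 1 := by
  classical
  have hirr := irreducible_polyQ_two_two_two
  have hsub : Subsingleton {φ : K →+* ℂ // NumberField.ComplexEmbedding.IsReal φ} := by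
    refine ⟨fun φ φ' => Subtype.ext ?_⟩
    have key : ∀ ψ : {φ : K →+* ℂ // NumberField.ComplexEmbedding.IsReal φ},
        ψ.1 θ = ((ψ.2.embedding θ : ℝ) : ℂ) ∧
          (ψ.2.embedding θ) ^ 3 + 2 * (ψ.2.embedding θ) ^ 2 + 2 * ψ.2.embedding θ + 2 = 0 := by
      intro ψ
      refine ⟨(NumberField.ComplexEmbedding.IsReal.coe_embedding_apply ψ.2 θ).symm, ?_⟩
      have h := congrArg ψ.2.embedding (theta_rel_two hθ)
      rw [map_add, map_add, map_add, map_mul, map_mul, map_pow, map_pow, map_zero] at h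
      have h2 : ψ.2.embedding (2 : K) = 2 := map_ofNat ψ.2.embedding 2
      rw [h2] at h
      exact h
    obtain ⟨e1, r1⟩ := key φ
    obtain ⟨e2, r2⟩ := key φ'
    have hθeq : φ.1 θ = φ'.1 θ := by rw [e1, e2, real_root_unique r1 r2]
    have halg : (φ.1 : K →+* ℂ).toRatAlgHom = (φ'.1 : K →+* ℂ).toRatAlgHom := by
      apply (MonicCubic.pb hirr hθ h3).algHom_ext
      rw [MonicCubic.pb_gen, RingHom.toRatAlgHom_apply, RingHom.toRatAlgHom_apply]
      exact hθeq
    exact RingHom.ext fun x => by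
      simpa only [RingHom.toRatAlgHom_apply] using DFunLike.congr_fun halg x
  have hreal : NumberField.InfinitePlace.nrRealPlaces K ≤ 1 := by
    rw [← NumberField.InfinitePlace.card_real_embeddings]
    exact Fintype.card_le_one_iff_subsingleton.2 hsub
  have h1 := NumberField.InfinitePlace.card_add_two_mul_card_eq_rank K
  have h2 := NumberField.InfinitePlace.card_eq_nrRealPlaces_add_nrComplexPlaces K
  rw [h3] at h1
  rw [NumberField.Units.rank, h2]
  omega

/-! ## §2 The units of the order `Λ₁ = ℤ[θ] = ⟨1, θ, θ²⟩_ℤ` are `±η₀^ℤ` -/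

omit [NumberField K] in
/-- Elements of `Λ₁ = ⟨1, θ, θ²⟩_ℤ` are algebraic integers. [folklore] -/
private theorem isIntegral_of_mem_span₁ (hθ : aeval θ (MonicCubic.poly 2 2 2) = 0) {c : K}
    (hc : c ∈ span ℤ ({1, θ, θ ^ 2} : Set K)) : IsIntegral ℤ c := by
  obtain ⟨u, v, w, rfl⟩ := exists_coords_of_mem_span₁ hc
  have hθi : IsIntegral ℤ θ := MonicCubic.isIntegral_of_aeval hθ
  have hi : ∀ n : ℤ, IsIntegral ℤ (n : K) := fun n => by
    simpa using (isIntegral_algebraMap (R := ℤ) (A := K) (x := n))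
  exact ((hi u).add ((hi v).mul hθi)).add ((hi w).mul (hθi.pow 2))

omit [NumberField K] in
/-- `Λ₁` is closed under products. [cite: HertlingLarabi2026b, §8 («`Λ₁ := Λ_max = ℤ[β]`»), chunk p0024] -/
private theorem mul_mem_span₁ (hθ : aeval θ (MonicCubic.poly 2 2 2) = 0) {c d : K}
    (hc : c ∈ span ℤ ({1, θ, θ ^ 2} : Set K)) (hd : d ∈ span ℤ ({1, θ, θ ^ 2} : Set K)) :
    c * d ∈ span ℤ ({1, θ, θ ^ 2} : Set K) :=
  span₁_mul_le (theta_rel_two hθ) (Submodule.mul_mem_mul hc hd)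

omit [NumberField K] in
/-- `Λ₁` is closed under natural powers. [folklore] -/
private theorem pow_mem_span₁ (hθ : aeval θ (MonicCubic.poly 2 2 2) = 0) {c : K}
    (hc : c ∈ span ℤ ({1, θ, θ ^ 2} : Set K)) (n : ℕ) : c ^ n ∈ span ℤ ({1, θ, θ ^ 2} : Set K) := by
  induction n with
  | zero => rw [pow_zero]; exact one_mem_span₁ θ
  | succ n ih =>
    have h := mul_mem_span₁ hθ ih hc
    rwa [← pow_succ] at h

omit [NumberField K] in
/-- Integer powers of a unit of `Λ₁` lie in `Λ₁`. [folklore] -/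
private theorem zpow_mem_span₁ (hθ : aeval θ (MonicCubic.poly 2 2 2) = 0) {c x : K}
    (hc : c ∈ span ℤ ({1, θ, θ ^ 2} : Set K)) (hx : x ∈ span ℤ ({1, θ, θ ^ 2} : Set K)) (hcx : c * x = 1)
    (n : ℤ) : c ^ n ∈ span ℤ ({1, θ, θ ^ 2} : Set K) := by
  have hinv : c⁻¹ = x := inv_eq_of_mul_eq_one_right hcx
  obtain ⟨m, rfl | rfl⟩ := Int.eq_nat_or_neg n
  · rw [zpow_natCast]; exact pow_mem_span₁ hθ hc m
  · rw [zpow_neg, zpow_natCast, ← inv_pow, hinv]; exact pow_mem_span₁ hθ hx m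

omit [NumberField K] in
/-- Coercion of products of units of `𝓞 K` into `K`. [folklore] -/
private theorem coe_units_mul (v w : (𝓞 K)ˣ) :
    (((v * w : (𝓞 K)ˣ) : 𝓞 K) : K) = ((v : 𝓞 K) : K) * ((w : 𝓞 K) : K) :=
  map_mul (algebraMap (𝓞 K) K) _ _

omit [NumberField K] in
/-- Coercion of integer powers of units of `𝓞 K` into `K`. [folklore] -/
private theorem coe_units_zpow (v : (𝓞 K)ˣ) (k : ℤ) :
    (((v ^ k : (𝓞 K)ˣ) : 𝓞 K) : K) = (((v : 𝓞 K) : K)) ^ k := by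
  have h1 : ∀ w : (𝓞 K)ˣ,
      ((w : 𝓞 K) : K) = ((Units.map ((algebraMap (𝓞 K) K).toMonoidHom) w : Kˣ) : K) := fun w => rfl
  rw [h1, h1, map_zpow, Units.val_zpow_eq_zpow_val]

set_option maxSynthPendingDepth 3 in
/-- **Dirichlet for the order `ℤ[θ]`: its unit group is `{±η₀^m | m ∈ ℤ}` for one unit `η₀`** (the torsion of `K`
is `±1` in odd degree, the unit rank is `1` by §1, and the units of `Λ₁ = ℤ[θ]` inside `𝓞_Kˣ` map onto a subgroup
of `𝓞_Kˣ/±1 ≅ ℤ`, which is cyclic).  HL: «`Λ_max^{unit} = {±(β+1)^l | l ∈ ℤ}`» (cited from [LMFDB23]; that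
`η₀` may be taken to be `β + 1` is NOT used or proved here).
[cite: HertlingLarabi2026b, §8 («`Λ₁^{unit} = {±(β+1)^l | l ∈ ℤ}`»), chunk p0025] -/
theorem exists_generator_units_span₁ (hθ : aeval θ (MonicCubic.poly 2 2 2) = 0) (h3 : finrank ℚ K = 3) :
    ∃ η y : K, η ∈ span ℤ ({1, θ, θ ^ 2} : Set K) ∧ y ∈ span ℤ ({1, θ, θ ^ 2} : Set K) ∧ η * y = 1 ∧
      ∀ c x : K, c ∈ span ℤ ({1, θ, θ ^ 2} : Set K) → x ∈ span ℤ ({1, θ, θ ^ 2} : Set K) → c * x = 1 →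
        ∃ m : ℤ, c = η ^ m ∨ c = -η ^ m := by
  classical
  have hrank := units_rank_eq_one hθ h3
  have hodd : Odd (finrank ℚ K) := by rw [h3]; decide
  let i₀ : Fin (NumberField.Units.rank K) := ⟨0, by rw [hrank]; exact zero_lt_one⟩
  -- the coordinate of a unit modulo torsion on the (one-element) basis of `𝓞_Kˣ/torsion`
  let F : (𝓞 K)ˣ → ℤ := fun v =>
    (NumberField.Units.basisModTorsion K).repr
      (Additive.ofMul (QuotientGroup.mk' (NumberField.Units.torsion K) v)) i₀
  have hFmul : ∀ v w, F (v * w) = F v + F w := by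
    intro v w
    simp only [F, map_mul, ofMul_mul, map_add, Finsupp.add_apply]
  have hF1 : ∀ v, F v = 0 → v = 1 ∨ v = -1 := by
    intro v hv
    have hall : (NumberField.Units.basisModTorsion K).repr
        (Additive.ofMul (QuotientGroup.mk' (NumberField.Units.torsion K) v)) = 0 := by
      refine Finsupp.ext fun i => ?_
      have hi : i = i₀ := Fin.ext (by have := i.2; simp only [i₀]; omega)
      rw [hi, Finsupp.zero_apply]
      exact hv
    have hq : QuotientGroup.mk' (NumberField.Units.torsion K) v = 1 :=
      ofMul_eq_zero.1 ((LinearEquiv.map_eq_zero_iff _).1 hall)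
    have hmem : v ∈ NumberField.Units.torsion K := (QuotientGroup.eq_one_iff v).1 hq
    exact NumberField.Units.torsion_eq_one_or_neg_one_of_odd_finrank hodd ⟨v, hmem⟩
  let Fh : Additive (𝓞 K)ˣ →+ ℤ :=
    { toFun := fun a => F (Additive.toMul a)
      map_zero' := by
        show F 1 = 0
        have h := hFmul 1 1
        rw [one_mul] at h
        omega
      map_add' := fun a b => hFmul _ _ }
  have hFzpow : ∀ (v : (𝓞 K)ˣ) (k : ℤ), F (v ^ k) = k * F v := by
    intro v k
    have h := map_zsmul Fh k (Additive.ofMul v)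
    rw [← ofMul_zpow] at h
    simpa [Fh, smul_eq_mul] using h
  have hFinv : ∀ v : (𝓞 K)ˣ, F v⁻¹ = -F v := by
    intro v
    have h := hFzpow v (-1)
    rwa [zpow_neg, zpow_one, neg_one_mul] at h
  -- the subgroup of `ℤ` of coordinates of units of `Λ₁`
  let S : Set ℤ := {n | ∃ v : (𝓞 K)ˣ, ((v : 𝓞 K) : K) ∈ span ℤ ({1, θ, θ ^ 2} : Set K) ∧
      (((v⁻¹ : (𝓞 K)ˣ) : 𝓞 K) : K) ∈ span ℤ ({1, θ, θ ^ 2} : Set K) ∧ F v = n}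
  let H : AddSubgroup ℤ :=
    { carrier := S
      zero_mem' := ⟨1, by simpa using one_mem_span₁ θ, by simpa using one_mem_span₁ θ, by
        have h := hFmul 1 1; rw [one_mul] at h; omega⟩
      add_mem' := by
        rintro _ _ ⟨v, hv, hv', rfl⟩ ⟨w, hw, hw', rfl⟩
        refine ⟨v * w, ?_, ?_, hFmul v w⟩
        · rw [coe_units_mul]; exact mul_mem_span₁ hθ hv hw
        · rw [mul_inv, coe_units_mul]; exact mul_mem_span₁ hθ hv' hw'
      neg_mem' := by
        rintro _ ⟨v, hv, hv', rfl⟩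
        exact ⟨v⁻¹, hv', by rw [inv_inv]; exact hv, hFinv v⟩ }
  obtain ⟨a, ha⟩ := Int.subgroup_cyclic H
  have haH : a ∈ H := by rw [ha]; exact AddSubgroup.subset_closure rfl
  obtain ⟨v₀, hv₀, hv₀', hFa⟩ := haH
  refine ⟨((v₀ : 𝓞 K) : K), (((v₀⁻¹ : (𝓞 K)ˣ) : 𝓞 K) : K), hv₀, hv₀', ?_, ?_⟩
  · rw [← map_mul, ← Units.val_mul, mul_inv_cancel, Units.val_one, map_one]
  · intro c x hc hx hcx
    -- `c` as a unit of `𝓞 K`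
    let v : (𝓞 K)ˣ := ⟨⟨c, isIntegral_of_mem_span₁ hθ hc⟩, ⟨x, isIntegral_of_mem_span₁ hθ hx⟩,
      RingOfIntegers.ext (by simpa using hcx), RingOfIntegers.ext (by simpa [mul_comm] using hcx)⟩
    have hvc : ((v : 𝓞 K) : K) = c := rfl
    have hvx : (((v⁻¹ : (𝓞 K)ˣ) : 𝓞 K) : K) = x := rfl
    have hmem : F v ∈ H := ⟨v, by rw [hvc]; exact hc, by rw [hvx]; exact hx, rfl⟩
    rw [ha, AddSubgroup.mem_closure_singleton] at hmem
    obtain ⟨k, hk⟩ := hmem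
    have hw : F (v * (v₀ ^ k)⁻¹) = 0 := by
      rw [hFmul, hFinv, hFzpow, hFa, ← hk, smul_eq_mul]; ring
    refine ⟨k, ?_⟩
    rcases hF1 _ hw with h | h
    · left
      have h' : v = v₀ ^ k := by rw [mul_inv_eq_iff_eq_mul.1 h, one_mul]
      rw [← hvc, h', coe_units_zpow]
    · right
      have h' : v = -v₀ ^ k := by rw [mul_inv_eq_iff_eq_mul.1 h, neg_one_mul]
      rw [← hvc, h', Units.val_neg]
      exact (map_neg (algebraMap (𝓞 K) K) _).trans (congrArg Neg.neg (coe_units_zpow v₀ k))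

/-! ## §3 `±(θ + 1)` are not squares in `ℤ[θ]` (residues at the degree-one prime `(13, θ − 10)`) -/

/-- A ring homomorphism `ℤ[θ] → 𝔽₁₃` with `θ ↦ 10` (`10³ + 2·10² + 2·10 + 2 = 1222 = 13·94`), on the subring
`ℤ[θ] = adjoin ℤ {θ}` of `𝓞 K` (it is `ℤ[X]/(f) → 𝔽₁₃` through Mathlib's `minpoly.equivAdjoin`). [folklore] -/
private theorem exists_hom_zmod13 (hθ : aeval θ (MonicCubic.poly 2 2 2) = 0) :
    ∃ ψ : Algebra.adjoin ℤ ({MonicCubic.thetaInt hθ} : Set (𝓞 K)) →+* ZMod 13,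
      ψ ⟨MonicCubic.thetaInt hθ, Algebra.self_mem_adjoin_singleton ℤ _⟩ = 10 := by
  have hirr := irreducible_polyQ_two_two_two
  have key : ∀ g : ℤ[X], g = minpoly ℤ (MonicCubic.thetaInt hθ) → g = MonicCubic.poly 2 2 2 →
      ∃ ψ : Algebra.adjoin ℤ ({MonicCubic.thetaInt hθ} : Set (𝓞 K)) →+* ZMod 13,
        ψ ⟨MonicCubic.thetaInt hθ, Algebra.self_mem_adjoin_singleton ℤ _⟩ = 10 := by
    intro g hg hg'
    subst hg
    have hint : IsIntegral ℤ (MonicCubic.thetaInt hθ) := Algebra.IsIntegral.isIntegral _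
    let e₁ := minpoly.equivAdjoin hint
    have hev : (minpoly ℤ (MonicCubic.thetaInt hθ)).eval₂ (Int.castRingHom (ZMod 13)) 10 = 0 := by
      rw [hg']
      simp only [MonicCubic.poly, eval₂_add, eval₂_mul, eval₂_X_pow, eval₂_C, eval₂_X, Int.coe_castRingHom]
      decide
    refine ⟨(AdjoinRoot.lift (Int.castRingHom (ZMod 13)) 10 hev).comp e₁.symm.toRingEquiv.toRingHom, ?_⟩
    have h1 : e₁ (AdjoinRoot.root _) = ⟨MonicCubic.thetaInt hθ, Algebra.self_mem_adjoin_singleton ℤ _⟩ := by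
      apply Subtype.ext
      change ((minpoly.equivAdjoin hint (AdjoinRoot.mk _ X) : Algebra.adjoin ℤ _) : 𝓞 K) = _
      rw [minpoly.coe_equivAdjoin]
      exact AdjoinRoot.Minpoly.coe_toAdjoin_mk_X
    rw [RingHom.comp_apply]
    change AdjoinRoot.lift _ _ hev (e₁.symm _) = _
    rw [← h1, AlgEquiv.symm_apply_apply, AdjoinRoot.lift_root]
  exact key _ rfl (MonicCubic.minpoly_thetaInt hirr hθ)

/-- **`β + 1` and `−(β + 1)` are not squares in `Λ₁ = ℤ[β]`**: under `ℤ[β] → 𝔽₁₃`, `β ↦ 10`, they go to `11`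
and `2`, which are quadratic non-residues modulo `13`.  (This is what is needed of HL's cited fact
`Λ₁^{unit} = {±(β+1)^l}`: the unit `β + 1` is not a square, so it generates the units modulo `±` and squares —
see §4.) [cite: HertlingLarabi2026b, §8 («`Λ₁^{unit} = {±(β+1)^l | l ∈ ℤ}`»), chunk p0025] -/
theorem sq_ne_theta_add_one (hθ : aeval θ (MonicCubic.poly 2 2 2) = 0) {η : K}
    (hη : η ∈ span ℤ ({1, θ, θ ^ 2} : Set K)) : η ^ 2 ≠ θ + 1 ∧ η ^ 2 ≠ -(θ + 1) := by
  obtain ⟨ψ, hψ⟩ := exists_hom_zmod13 hθ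
  obtain ⟨u, v, w, rfl⟩ := exists_coords_of_mem_span₁ hη
  have hTmem : MonicCubic.thetaInt hθ ∈ Algebra.adjoin ℤ ({MonicCubic.thetaInt hθ} : Set (𝓞 K)) :=
    Algebra.self_mem_adjoin_singleton ℤ _
  have hmem : (u : 𝓞 K) + v * MonicCubic.thetaInt hθ + w * MonicCubic.thetaInt hθ ^ 2 ∈
      Algebra.adjoin ℤ ({MonicCubic.thetaInt hθ} : Set (𝓞 K)) :=
    add_mem (add_mem (intCast_mem _ u) (mul_mem (intCast_mem _ v) hTmem))
      (mul_mem (intCast_mem _ w) (pow_mem hTmem 2))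
  have hsq13 : ∀ z : ZMod 13, z ^ 2 ≠ 10 + 1 ∧ z ^ 2 ≠ -(10 + 1) := by decide
  -- transport an identity `η² = ±(θ+1)` from `K` to `𝓞 K`, to `ℤ[θ]`, to `𝔽₁₃`
  have transport : ∀ s : ℤ, ((u : K) + v * θ + w * θ ^ 2) ^ 2 = s * (θ + 1) →
      (ψ ⟨_, hmem⟩) ^ 2 = (s : ZMod 13) * (10 + 1) := by
    intro s hs
    have hO : ((u : 𝓞 K) + v * MonicCubic.thetaInt hθ + w * MonicCubic.thetaInt hθ ^ 2) ^ 2 =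
        s * (MonicCubic.thetaInt hθ + 1) := by
      apply RingOfIntegers.ext
      simp only [map_pow, map_mul, map_intCast, map_add, map_one, MonicCubic.coe_thetaInt]
      exact hs
    have hA : (⟨_, hmem⟩ : Algebra.adjoin ℤ ({MonicCubic.thetaInt hθ} : Set (𝓞 K))) ^ 2 =
        s * (⟨MonicCubic.thetaInt hθ, hTmem⟩ + 1) :=
      Subtype.ext hO
    have h := congrArg ψ hA
    rw [map_pow, map_mul, map_intCast, map_add, map_one, hψ] at h
    exact h
  constructor
  · intro h
    have h1 := transport 1 (by rw [h]; push_cast; ring)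
    exact (hsq13 _).1 (by rw [h1]; push_cast; ring)
  · intro h
    have h1 := transport (-1) (by rw [h]; push_cast; ring)
    exact (hsq13 _).2 (by rw [h1]; push_cast; ring)

/-! ## §4 Every unit of `ℤ[θ]` is `±(θ + 1)^j η²`, `j ∈ {0, 1}` -/

/-- **The units of `Λ₁ = ℤ[β]` modulo squares are represented by `±1, ±(β + 1)`**: every unit `c` of `ℤ[β]` is
`c = s·(β + 1)^j·η²` with `s = ±1`, `j ∈ {0, 1}` and `η` a unit of `ℤ[β]` (write `c = ±η₀^m`, `β + 1 = ±η₀^k` by §2;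
`k` is odd by §3).  HL: «`Λ₁^{unit} = {±(β+1)^l | l ∈ ℤ}`» (from [LMFDB23]); this weaker form is what their count
«`(32 elements) − (16 elements)`» uses. [cite: HertlingLarabi2026b, §8 («`(Λ₁/C₄)^{unit} − (Λ₄/C₄)^{unit}·{(β+1)^l | l ∈ {0,1,2,3}} = (32 elements) − (16 elements)`»), chunk p0025] -/
theorem unit_eq_sign_mul_pow_mul_sq (hθ : aeval θ (MonicCubic.poly 2 2 2) = 0) (h3 : finrank ℚ K = 3)
    {c x : K} (hc : c ∈ span ℤ ({1, θ, θ ^ 2} : Set K)) (hx : x ∈ span ℤ ({1, θ, θ ^ 2} : Set K))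
    (hcx : c * x = 1) :
    ∃ (s : ℤ) (j : ℕ) (η y : K), (s = 1 ∨ s = -1) ∧ j ≤ 1 ∧ η ∈ span ℤ ({1, θ, θ ^ 2} : Set K) ∧
      y ∈ span ℤ ({1, θ, θ ^ 2} : Set K) ∧ η * y = 1 ∧ c = s * (θ + 1) ^ j * η ^ 2 := by
  have hβ := theta_rel_two hθ
  obtain ⟨η₀, y₀, hη₀, hy₀, hη₀y₀, hgen⟩ := exists_generator_units_span₁ hθ h3
  have hη₀0 : η₀ ≠ 0 := left_ne_zero_of_mul_eq_one hη₀y₀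
  have hzmem : ∀ n : ℤ, η₀ ^ n ∈ span ℤ ({1, θ, θ ^ 2} : Set K) := zpow_mem_span₁ hθ hη₀ hy₀ hη₀y₀
  -- `θ + 1` is a unit of `Λ₁`
  have hθ1 : θ + 1 ∈ span ℤ ({1, θ, θ ^ 2} : Set K) :=
    add_mem (subset_span (by simp)) (one_mem_span₁ θ)
  have hθ1' : -(θ ^ 2 + θ + 1) ∈ span ℤ ({1, θ, θ ^ 2} : Set K) :=
    neg_mem (add_mem (add_mem (subset_span (by simp)) (subset_span (by simp))) (one_mem_span₁ θ))
  obtain ⟨k, hk⟩ := hgen (θ + 1) (-(θ ^ 2 + θ + 1)) hθ1 hθ1' (add_one_mul_eq_one hβ)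
  obtain ⟨m, hm⟩ := hgen c x hc hx hcx
  -- `k` is odd: otherwise `±(θ + 1)` would be the square of `η₀^(k/2) ∈ Λ₁`
  have hkodd : Odd k := by
    rcases Int.even_or_odd k with ⟨k', hk'⟩ | hko
    · exfalso
      have hsq : η₀ ^ k = (η₀ ^ k') ^ 2 := by rw [hk', sq, ← zpow_add₀ hη₀0]
      have hns := sq_ne_theta_add_one hθ (hzmem k')
      rcases hk with h | h
      · exact hns.1 (by rw [← hsq, ← h])
      · exact hns.2 (by rw [← hsq, h, neg_neg])
    · exact hko
  obtain ⟨k', hk'⟩ := hkodd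
  -- `η₀^k = t·(θ + 1)` with `t = ±1`
  have hηk : ∃ t : ℤ, (t = 1 ∨ t = -1) ∧ η₀ ^ k = t * (θ + 1) := by
    rcases hk with h | h
    · exact ⟨1, Or.inl rfl, by rw [← h]; simp⟩
    · exact ⟨-1, Or.inr rfl, by rw [h]; simp⟩
  obtain ⟨t, ht, hηkt⟩ := hηk
  -- `c = r·η₀^m` with `r = ±1`
  have hcm : ∃ r : ℤ, (r = 1 ∨ r = -1) ∧ c = r * η₀ ^ m := by
    rcases hm with h | h
    · exact ⟨1, Or.inl rfl, by rw [h]; simp⟩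
    · exact ⟨-1, Or.inr rfl, by rw [h]; simp⟩
  obtain ⟨r, hr, hcr⟩ := hcm
  rcases Int.even_or_odd m with ⟨d, hd⟩ | ⟨d, hd⟩
  · -- `m = 2d`: `c = r·(η₀^d)²`
    refine ⟨r, 0, η₀ ^ d, η₀ ^ (-d), hr, zero_le_one, hzmem d, hzmem (-d), ?_, ?_⟩
    · rw [← zpow_add₀ hη₀0, add_neg_cancel, zpow_zero]
    · rw [hcr, hd, pow_zero, mul_one, sq, ← zpow_add₀ hη₀0]
  · -- `m = 2d + 1 = k + 2(d - k')`: `c = r·η₀^k·(η₀^(d-k'))² = (rt)·(θ+1)·(η₀^(d-k'))²`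
    refine ⟨r * t, 1, η₀ ^ (d - k'), η₀ ^ (-(d - k')), ?_, le_rfl, hzmem _, hzmem _, ?_, ?_⟩
    · rcases hr with rfl | rfl <;> rcases ht with rfl | rfl <;> simp
    · rw [← zpow_add₀ hη₀0, add_neg_cancel, zpow_zero]
    · have hm' : m = k + ((d - k') + (d - k')) := by omega
      rw [hcr, hm', zpow_add₀ hη₀0, zpow_add₀ hη₀0, hηkt, pow_one, sq]
      push_cast
      ring

/-! ## §5 No unit of `ℤ[θ]` lies in `L₄ = ⟨2, 2θ, 2θ² + 1⟩` (the computation modulo `C₄ = 4Λ₁`) -/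

omit [NumberField K] in
/-- `(u + vθ + wθ²)² = (u² − 4vw + 4w²) + (2uv − 4vw + 2w²)θ + (2uw + v² − 4vw + 2w²)θ²`.
[cite: HertlingLarabi2026b, §8 («`0 = β³ + 2β² + 2β + 2`»), chunk p0024] -/
theorem coords_sq (hθ : aeval θ (MonicCubic.poly 2 2 2) = 0) (u v w : ℤ) :
    ((u : K) + v * θ + w * θ ^ 2) ^ 2 =
      ((u ^ 2 - 4 * v * w + 4 * w ^ 2 : ℤ) : K) + ((2 * u * v - 4 * v * w + 2 * w ^ 2 : ℤ) : K) * θ +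
        ((2 * u * w + v ^ 2 - 4 * v * w + 2 * w ^ 2 : ℤ) : K) * θ ^ 2 := by
  have hβ := theta_rel_two hθ
  push_cast
  linear_combination ((2 * v * w : K) + (w : K) ^ 2 * (θ - 2)) * hβ

omit [NumberField K] in
/-- `(θ + 1)(U + Vθ + Wθ²) = (U − 2W) + (U + V − 2W)θ + (V − W)θ²`.
[cite: HertlingLarabi2026b, §8 («`0 = β³ + 2β² + 2β + 2`»), chunk p0024] -/
theorem coords_theta_add_one_mul (hθ : aeval θ (MonicCubic.poly 2 2 2) = 0) (U V W : ℤ) :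
    (θ + 1) * ((U : K) + V * θ + W * θ ^ 2) =
      ((U - 2 * W : ℤ) : K) + ((U + V - 2 * W : ℤ) : K) * θ + ((V - W : ℤ) : K) * θ ^ 2 := by
  have hβ := theta_rel_two hθ
  push_cast
  linear_combination (W : K) * hβ

omit [NumberField K] in
/-- `(u + vθ + wθ²)(u′ + v′θ + w′θ²)` in coordinates. [cite: HertlingLarabi2026b, §8 («`0 = β³ + 2β² + 2β + 2`»), chunk p0024] -/
theorem coords_mul (hθ : aeval θ (MonicCubic.poly 2 2 2) = 0) (u v w u' v' w' : ℤ) :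
    ((u : K) + v * θ + w * θ ^ 2) * ((u' : K) + v' * θ + w' * θ ^ 2) =
      ((u * u' - 2 * (v * w' + w * v') + 4 * w * w' : ℤ) : K) +
        ((u * v' + v * u' - 2 * (v * w' + w * v') + 2 * w * w' : ℤ) : K) * θ +
        ((u * w' + v * v' + w * u' - 2 * (v * w' + w * v') + 2 * w * w' : ℤ) : K) * θ ^ 2 := by
  have hβ := theta_rel_two hθ
  push_cast
  linear_combination ((v * w' + w * v' : K) + (w * w' : K) * (θ - 2)) * hβ

/-- A unit `u + vθ + wθ²` of `ℤ[θ]` has `u` odd (modulo `2Λ₁` the ring is `𝔽₂[t]/(t³)`, where the units are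
`1 + …`). [cite: HertlingLarabi2026b, §8 («all summands except `ℤ_m·[1]` are nilpotent»), chunk p0025] -/
theorem odd_of_unit (hθ : aeval θ (MonicCubic.poly 2 2 2) = 0) (h3 : finrank ℚ K = 3) {u v w : ℤ} {x : K}
    (hx : x ∈ span ℤ ({1, θ, θ ^ 2} : Set K)) (h : ((u : K) + v * θ + w * θ ^ 2) * x = 1) : Odd u := by
  have hli := linearIndependent_one_theta_sq hθ h3
  obtain ⟨u', v', w', rfl⟩ := exists_coords_of_mem_span₁ hx
  rw [coords_mul hθ] at h
  have h1 : ((u * u' - 2 * (v * w' + w * v') + 4 * w * w' : ℤ) : K) +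
      ((u * v' + v * u' - 2 * (v * w' + w * v') + 2 * w * w' : ℤ) : K) * θ +
      ((u * w' + v * v' + w * u' - 2 * (v * w' + w * v') + 2 * w * w' : ℤ) : K) * θ ^ 2 =
      ((1 : ℤ) : K) + ((0 : ℤ) : K) * θ + ((0 : ℤ) : K) * θ ^ 2 := by
    rw [h]; push_cast; ring
  obtain ⟨e, -, -⟩ := coords_eq hli h1
  have hodd : Odd (u * u') := ⟨(v * w' + w * v') - 2 * w * w', by linear_combination e⟩
  exact (Int.odd_mul.1 hodd).1

/-- The finite check behind «`(32 elements) − (16 elements)`», modulo `4`: for `u` odd and `s = ±1`, neither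
`s·η²` nor `s·(θ + 1)·η²` (`η = u + vθ + wθ²`) has coordinates `(x, y, z)` with `y` even, `z = 2c` and `x ≡ c`
`(mod 2)` — the membership condition of `L₄ = ⟨2, 2θ, 2θ² + 1⟩`. [folklore] -/
private theorem parity_core (s u v w : ℤ) (hs : s = 1 ∨ s = -1) (hu : Odd u) :
    ¬ (2 ∣ s * (2 * u * v - 4 * v * w + 2 * w ^ 2) ∧ ∃ c : ℤ, s * (2 * u * w + v ^ 2 - 4 * v * w + 2 * w ^ 2) = 2 * c ∧
        2 ∣ s * (u ^ 2 - 4 * v * w + 4 * w ^ 2) - c) ∧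
    ¬ (2 ∣ s * ((u ^ 2 - 4 * v * w + 4 * w ^ 2) + (2 * u * v - 4 * v * w + 2 * w ^ 2) -
          2 * (2 * u * w + v ^ 2 - 4 * v * w + 2 * w ^ 2)) ∧
        ∃ c : ℤ, s * ((2 * u * v - 4 * v * w + 2 * w ^ 2) - (2 * u * w + v ^ 2 - 4 * v * w + 2 * w ^ 2)) = 2 * c ∧
          2 ∣ s * ((u ^ 2 - 4 * v * w + 4 * w ^ 2) - 2 * (2 * u * w + v ^ 2 - 4 * v * w + 2 * w ^ 2)) - c) := by
  -- everything is decided modulo `4`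
  have key : ∀ s u v w c : ZMod 4, (s = 1 ∨ s = -1) → 2 * u - 2 = 0 →
      ¬ (2 * (s * (2 * u * v - 4 * v * w + 2 * w ^ 2)) = 0 ∧
          s * (2 * u * w + v ^ 2 - 4 * v * w + 2 * w ^ 2) = 2 * c ∧
          2 * (s * (u ^ 2 - 4 * v * w + 4 * w ^ 2) - c) = 0) ∧
      ¬ (2 * (s * ((u ^ 2 - 4 * v * w + 4 * w ^ 2) + (2 * u * v - 4 * v * w + 2 * w ^ 2) -
            2 * (2 * u * w + v ^ 2 - 4 * v * w + 2 * w ^ 2))) = 0 ∧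
          s * ((2 * u * v - 4 * v * w + 2 * w ^ 2) - (2 * u * w + v ^ 2 - 4 * v * w + 2 * w ^ 2)) = 2 * c ∧
          2 * (s * ((u ^ 2 - 4 * v * w + 4 * w ^ 2) - 2 * (2 * u * w + v ^ 2 - 4 * v * w + 2 * w ^ 2)) - c) = 0) := by
    decide
  -- transfer of `2 ∣ y` to `ℤ/4`
  have tr : ∀ y : ℤ, 2 ∣ y → ((2 * y : ℤ) : ZMod 4) = 0 := by
    rintro y ⟨t, rfl⟩
    exact (ZMod.intCast_zmod_eq_zero_iff_dvd _ 4).2 ⟨t, by ring⟩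
  have hs4 : (s : ZMod 4) = 1 ∨ (s : ZMod 4) = -1 := by
    rcases hs with rfl | rfl
    · left; push_cast; rfl
    · right; push_cast; rfl
  have hu4 : 2 * (u : ZMod 4) - 2 = 0 := by
    obtain ⟨a, rfl⟩ := hu
    have h := (ZMod.intCast_zmod_eq_zero_iff_dvd (2 * (2 * a + 1) - 2) 4).2 ⟨a, by ring⟩
    push_cast at h ⊢
    exact h
  constructor
  · rintro ⟨h1, c, h2, h3⟩
    have h1' := tr _ h1
    have h2' := congrArg (Int.cast : ℤ → ZMod 4) h2
    have h3' := tr _ h3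
    push_cast at h1' h2' h3'
    exact (key _ _ _ _ (c : ZMod 4) hs4 hu4).1 ⟨h1', h2', h3'⟩
  · rintro ⟨h1, c, h2, h3⟩
    have h1' := tr _ h1
    have h2' := congrArg (Int.cast : ℤ → ZMod 4) h2
    have h3' := tr _ h3
    push_cast at h1' h2' h3'
    exact (key _ _ _ _ (c : ZMod 4) hs4 hu4).2 ⟨h1', h2', h3'⟩

/-- **No unit of `Λ₁ = ℤ[β]` lies in `L₄ = ⟨2, 2β, 2β² + 1⟩_ℤ`** — HL's computation behind `|G([Λ₄]_ε)| = 2`: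
the units of `Λ₁` reduce modulo `C₄ = 4Λ₁` into the subgroup of `(Λ₁/C₄)^{unit}` (32 elements) generated by
`(Λ₄/C₄)^{unit}` and `β + 1` (16 elements), which misses the coset `a·(Λ₄/C₄)^{unit}`, `a = 1 + 2β²`, i.e. the units
of `L₄/C₄ = a·(Λ₄/C₄)` (by §4 a unit is `±(β+1)^j η²`; the check modulo `4` is `parity_core`).
[cite: HertlingLarabi2026b, §8 («`a := 1 + 2β²` works and gives `L₄ = C₄ + aΛ₄ = ⟨2, 2β, 2β² + 1⟩_ℤ`»), chunk p0025] -/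
theorem not_mem_spanL₄_of_unit (hθ : aeval θ (MonicCubic.poly 2 2 2) = 0) (h3 : finrank ℚ K = 3)
    {c x : K} (hc : c ∈ span ℤ ({1, θ, θ ^ 2} : Set K)) (hx : x ∈ span ℤ ({1, θ, θ ^ 2} : Set K))
    (hcx : c * x = 1) : c ∉ span ℤ ({2, 2 * θ, 2 * θ ^ 2 + 1} : Set K) := by
  have hli := linearIndependent_one_theta_sq hθ h3
  obtain ⟨s, j, η, y, hs, hj, hη, hy, hηy, hc_eq⟩ := unit_eq_sign_mul_pow_mul_sq hθ h3 hc hx hcx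
  obtain ⟨u, v, w, rfl⟩ := exists_coords_of_mem_span₁ hη
  have hu : Odd u := odd_of_unit hθ h3 hy hηy
  have hpc := parity_core s u v w hs hu
  intro hmem
  interval_cases j
  · have hc' : c = ((s * (u ^ 2 - 4 * v * w + 4 * w ^ 2) : ℤ) : K) +
        ((s * (2 * u * v - 4 * v * w + 2 * w ^ 2) : ℤ) : K) * θ +
        ((s * (2 * u * w + v ^ 2 - 4 * v * w + 2 * w ^ 2) : ℤ) : K) * θ ^ 2 := by
      rw [hc_eq, pow_zero, mul_one, coords_sq hθ]
      push_cast
      ring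
    rw [hc'] at hmem
    exact hpc.1 ((mem_spanL₄_iff hli _ _ _).1 hmem)
  · have hc' : c = ((s * ((u ^ 2 - 4 * v * w + 4 * w ^ 2) - 2 * (2 * u * w + v ^ 2 - 4 * v * w + 2 * w ^ 2)) : ℤ) : K) +
        ((s * ((u ^ 2 - 4 * v * w + 4 * w ^ 2) + (2 * u * v - 4 * v * w + 2 * w ^ 2) -
          2 * (2 * u * w + v ^ 2 - 4 * v * w + 2 * w ^ 2)) : ℤ) : K) * θ +
        ((s * ((2 * u * v - 4 * v * w + 2 * w ^ 2) - (2 * u * w + v ^ 2 - 4 * v * w + 2 * w ^ 2)) : ℤ) : K) *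
          θ ^ 2 := by
      rw [hc_eq, pow_one, coords_sq hθ, mul_assoc, coords_theta_add_one_mul hθ]
      push_cast
      ring
    rw [hc'] at hmem
    obtain ⟨h1, c', h2, h3'⟩ := (mem_spanL₄_iff hli _ _ _).1 hmem
    exact hpc.2 ⟨h1, c', h2, h3'⟩

/-! ## §6 Consequences: `[L₄]_ε ≠ [Λ₄]_ε`, and the cubic form of the conjugacy problem does not represent `±1` -/

omit [NumberField K] in
/-- Membership of an explicit `ℤ`-combination in a span of three elements. [folklore] -/
private theorem mem_span_triple_of_eq' {p q r x : K} (a b c : ℤ) (h : (a : K) * p + b * q + c * r = x) :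
    x ∈ span ℤ ({p, q, r} : Set K) :=
  mem_span_triple.2 ⟨a, b, c, by simpa only [zsmul_eq_mul] using h⟩

omit [NumberField K] in
/-- `L₄ = ⟨2, 2θ, 2θ² + 1⟩ ⊆ Λ₁`. [cite: HertlingLarabi2026b, §8 (8.2), chunk p0025] -/
theorem spanL₄_le_span₁ (θ : K) :
    span ℤ ({2, 2 * θ, 2 * θ ^ 2 + 1} : Set K) ≤ span ℤ ({1, θ, θ ^ 2} : Set K) := by
  refine span_le.2 ?_
  rintro x (rfl | rfl | rfl)
  · exact mem_span_triple_of_eq' 2 0 0 (by push_cast; ring)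
  · exact mem_span_triple_of_eq' 0 2 0 (by push_cast; ring)
  · exact mem_span_triple_of_eq' 1 0 2 (by push_cast; ring)

open Pointwise in
/-- **`[L₄]_ε ≠ [Λ₄]_ε`: `L₄ = ⟨2, 2β, 2β² + 1⟩` is not of the form `c·Λ₄`, `Λ₄ = ℤ[2β] = ⟨1, 2β, 4β²⟩`, for any
`c ∈ A`** (so the invertible `Λ₄`-ideal `L₄` is not principal, and `G([Λ₄]_ε)` has at least the two elements
`[Λ₄]_ε, [L₄]_ε`; HL: exactly two).  Proof: `c·Λ₄ = L₄` forces `c ∈ L₄` and `1 = (2β² + 1) − β²·2 ∈ cΛ₁`, so `c`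
would be a unit of `Λ₁` in `L₄`, excluded by §5.
[cite: HertlingLarabi2026b, §8 («`|G([Λ₄]_ε)| = ¼ · 32/4 = 2`», «`G([Λ₄]_ε) = {[Λ₄]_ε, [L₄]_ε}`»), chunk p0025] -/
theorem smul_span₄_ne_spanL₄ (hθ : aeval θ (MonicCubic.poly 2 2 2) = 0) (h3 : finrank ℚ K = 3) (c : K) :
    c • span ℤ ({1, 2 * θ, 4 * θ ^ 2} : Set K) ≠ span ℤ ({2, 2 * θ, 2 * θ ^ 2 + 1} : Set K) := by
  intro h
  have h44 : span ℤ ({1, 2 * θ, 4 * θ ^ 2} : Set K) ≤ span ℤ ({1, θ, θ ^ 2} : Set K) :=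
    (span₄_le_span₃ θ).trans ((span₃_le_span₂ θ).trans (span₂_le_span₁ θ))
  -- `c = c • 1 ∈ L₄ ⊆ Λ₁`
  have hcL : c ∈ span ℤ ({2, 2 * θ, 2 * θ ^ 2 + 1} : Set K) := by
    rw [← h]
    simpa using smul_mem_pointwise_smul (1 : K) c _ (one_mem_span₄ θ)
  have hcΛ : c ∈ span ℤ ({1, θ, θ ^ 2} : Set K) := spanL₄_le_span₁ θ hcL
  -- `2 = c·y₂` and `2θ² + 1 = c·y₁` with `y₁, y₂ ∈ Λ₄`
  have h2 : (2 : K) ∈ c • span ℤ ({1, 2 * θ, 4 * θ ^ 2} : Set K) := by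
    rw [h]; exact subset_span (by simp)
  have h1 : (2 * θ ^ 2 + 1 : K) ∈ c • span ℤ ({1, 2 * θ, 4 * θ ^ 2} : Set K) := by
    rw [h]; exact subset_span (by simp)
  obtain ⟨y₂, hy₂, hcy₂⟩ := (mem_smul_pointwise_iff_exists _ _ _).1 h2
  obtain ⟨y₁, hy₁, hcy₁⟩ := (mem_smul_pointwise_iff_exists _ _ _).1 h1
  rw [smul_eq_mul] at hcy₁ hcy₂
  have hx : y₁ - θ ^ 2 * y₂ ∈ span ℤ ({1, θ, θ ^ 2} : Set K) :=
    sub_mem (h44 hy₁) (mul_mem_span₁ hθ (subset_span (by simp)) (h44 hy₂))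
  have hcx : c * (y₁ - θ ^ 2 * y₂) = 1 := by
    rw [mul_sub, mul_left_comm, hcy₁, hcy₂]; ring
  exact not_mem_spanL₄_of_unit hθ h3 hcΛ hx hcx hcL

omit [NumberField K] in
/-- **The conjugating matrices `P` with `P·M_{Λ₄} = M_{L₄}·P` and the units they would produce.**  With
`(p, q, r)` the first column of `P`, `P = (w | M_{L₄}w | M_{L₄}²w)`, and `det P` is the cubic form
`D = 8p³ − 16p²q + 12p²r + 16pq² − 26pr² − 16q³ + 40q²r − 28qr² + 17r³`; the element
`c = 𝓑_{L₄}·(p, q, r) = (2p + r) + 2qβ + 2rβ² ∈ L₄` satisfies `c·x̃ = D` for the explicit `x̃ ∈ Λ₁` below (so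
`det P = ±1` would make `c` a unit of `Λ₁` lying in `L₄`). [cite: HertlingLarabi2026b, §8 (the matrices `M_{Λ₄} = (0 0 −16; 1 0 −8; 0 1 −4)`, `M_{L₄} = (0 −1 −2; 2 0 −3; 0 2 −4)`), chunk p0026] -/
theorem basisL₄_mul_adj_eq_det (hθ : aeval θ (MonicCubic.poly 2 2 2) = 0) (p q r : ℤ) :
    (((2 * p + r : ℤ) : K) + ((2 * q : ℤ) : K) * θ + ((2 * r : ℤ) : K) * θ ^ 2) *
        (((4 * p ^ 2 - 8 * p * q + 4 * p * r + 8 * q ^ 2 - 12 * q * r + r ^ 2 : ℤ) : K) +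
          ((-4 * p * q + 8 * q ^ 2 - 18 * q * r + 8 * r ^ 2 : ℤ) : K) * θ +
          ((-4 * p * r + 4 * q ^ 2 - 8 * q * r + 6 * r ^ 2 : ℤ) : K) * θ ^ 2) =
      ((8 * p ^ 3 - 16 * p ^ 2 * q + 12 * p ^ 2 * r + 16 * p * q ^ 2 - 26 * p * r ^ 2 - 16 * q ^ 3 +
        40 * q ^ 2 * r - 28 * q * r ^ 2 + 17 * r ^ 3 : ℤ) : K) := by
  have hβ := theta_rel_two hθ
  push_cast
  linear_combination (-(16 * p * q * r : K) - 8 * p * r ^ 2 * θ + 16 * p * r ^ 2 + 8 * q ^ 3 + 8 * q ^ 2 * r * θ -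
    16 * q ^ 2 * r - 16 * q * r ^ 2 * θ + 8 * q * r ^ 2 + 12 * r ^ 3 * θ - 8 * r ^ 3) * hβ

/-- **In the cubic field: the form `D` does not take the values `±1`** (otherwise the unit
`c = (2p + r) + 2qβ + 2rβ²` of `Λ₁` would lie in `L₄`). [cite: HertlingLarabi2026b, §8 («`|G([Λ₄]_ε)| = 2`»), chunk p0025] -/
theorem det_form_ne_of_root (hθ : aeval θ (MonicCubic.poly 2 2 2) = 0) (h3 : finrank ℚ K = 3) (p q r : ℤ) :
    8 * p ^ 3 - 16 * p ^ 2 * q + 12 * p ^ 2 * r + 16 * p * q ^ 2 - 26 * p * r ^ 2 - 16 * q ^ 3 +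
        40 * q ^ 2 * r - 28 * q * r ^ 2 + 17 * r ^ 3 ≠ 1 ∧
      8 * p ^ 3 - 16 * p ^ 2 * q + 12 * p ^ 2 * r + 16 * p * q ^ 2 - 26 * p * r ^ 2 - 16 * q ^ 3 +
        40 * q ^ 2 * r - 28 * q * r ^ 2 + 17 * r ^ 3 ≠ -1 := by
  have hli := linearIndependent_one_theta_sq hθ h3
  have key : ∀ D : ℤ, (D = 1 ∨ D = -1) →
      8 * p ^ 3 - 16 * p ^ 2 * q + 12 * p ^ 2 * r + 16 * p * q ^ 2 - 26 * p * r ^ 2 - 16 * q ^ 3 +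
        40 * q ^ 2 * r - 28 * q * r ^ 2 + 17 * r ^ 3 = D → False := by
    intro D hD hDeq
    have hid := basisL₄_mul_adj_eq_det hθ p q r
    rw [hDeq] at hid
    -- `c`, `x̃ ∈ Λ₁`, `c·(D·x̃) = 1`, `c ∈ L₄`
    have hc : ((2 * p + r : ℤ) : K) + ((2 * q : ℤ) : K) * θ + ((2 * r : ℤ) : K) * θ ^ 2 ∈
        span ℤ ({1, θ, θ ^ 2} : Set K) :=
      mem_span_triple_of_eq' (2 * p + r) (2 * q) (2 * r) (by push_cast; ring)
    have hx : (D : K) * (((4 * p ^ 2 - 8 * p * q + 4 * p * r + 8 * q ^ 2 - 12 * q * r + r ^ 2 : ℤ) : K) +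
          ((-4 * p * q + 8 * q ^ 2 - 18 * q * r + 8 * r ^ 2 : ℤ) : K) * θ +
          ((-4 * p * r + 4 * q ^ 2 - 8 * q * r + 6 * r ^ 2 : ℤ) : K) * θ ^ 2) ∈ span ℤ ({1, θ, θ ^ 2} : Set K) := by
      rw [← zsmul_eq_mul]
      exact Submodule.smul_mem _ D (mem_span_triple_of_eq' (4 * p ^ 2 - 8 * p * q + 4 * p * r + 8 * q ^ 2 - 12 * q * r + r ^ 2)
        (-4 * p * q + 8 * q ^ 2 - 18 * q * r + 8 * r ^ 2) (-4 * p * r + 4 * q ^ 2 - 8 * q * r + 6 * r ^ 2)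
        (by push_cast; ring))
    have hDD : (D : K) * D = 1 := by
      rcases hD with rfl | rfl <;> norm_num
    have hcx : (((2 * p + r : ℤ) : K) + ((2 * q : ℤ) : K) * θ + ((2 * r : ℤ) : K) * θ ^ 2) *
        ((D : K) * (((4 * p ^ 2 - 8 * p * q + 4 * p * r + 8 * q ^ 2 - 12 * q * r + r ^ 2 : ℤ) : K) +
          ((-4 * p * q + 8 * q ^ 2 - 18 * q * r + 8 * r ^ 2 : ℤ) : K) * θ +
          ((-4 * p * r + 4 * q ^ 2 - 8 * q * r + 6 * r ^ 2 : ℤ) : K) * θ ^ 2)) = 1 := by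
      rw [mul_left_comm, hid, hDD]
    have hL : ((2 * p + r : ℤ) : K) + ((2 * q : ℤ) : K) * θ + ((2 * r : ℤ) : K) * θ ^ 2 ∈
        span ℤ ({2, 2 * θ, 2 * θ ^ 2 + 1} : Set K) :=
      (mem_spanL₄_iff hli _ _ _).2 ⟨⟨q, rfl⟩, r, rfl, ⟨p, by ring⟩⟩
    exact not_mem_spanL₄_of_unit hθ h3 hc hx hcx hL
  exact ⟨fun h => key 1 (Or.inl rfl) h, fun h => key (-1) (Or.inr rfl) h⟩

/-- **The Diophantine corollary, unconditionally: `8p³ − 16p²q + 12p²r + 16pq² − 26pr² − 16q³ + 40q²r − 28qr² +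
17r³ ≠ ±1` for all integers `p, q, r`** (the determinant of any integer `P` with `P·M_{Λ₄} = M_{L₄}·P` is this form in
the first column of `P`; so `M_{Λ₄}` and `M_{L₄}` are not `GL₃(ℤ)`-conjugate — part II of
`LinearAlgebra/Matrix/GL3ZDadeTausskyZassenhausSixClasses`).  Here `K = ℚ[t]/(t³ + 2t² + 2t + 2)`.
[cite: HertlingLarabi2026b, §8 («representatives of the six `GL₃(ℤ)`-conjugacy classes»), chunk p0026] -/
theorem det_form_ne (p q r : ℤ) :
    8 * p ^ 3 - 16 * p ^ 2 * q + 12 * p ^ 2 * r + 16 * p * q ^ 2 - 26 * p * r ^ 2 - 16 * q ^ 3 +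
        40 * q ^ 2 * r - 28 * q * r ^ 2 + 17 * r ^ 3 ≠ 1 ∧
      8 * p ^ 3 - 16 * p ^ 2 * q + 12 * p ^ 2 * r + 16 * p * q ^ 2 - 26 * p * r ^ 2 - 16 * q ^ 3 +
        40 * q ^ 2 * r - 28 * q * r ^ 2 + 17 * r ^ 3 ≠ -1 := by
  haveI : Fact (Irreducible (MonicCubic.polyQ 2 2 2)) := ⟨irreducible_polyQ_two_two_two⟩
  have hne : MonicCubic.polyQ 2 2 2 ≠ 0 := (MonicCubic.monic_polyQ 2 2 2).ne_zero
  have h3 : finrank ℚ (AdjoinRoot (MonicCubic.polyQ 2 2 2)) = 3 := by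
    rw [(AdjoinRoot.powerBasis hne).finrank, AdjoinRoot.powerBasis_dim, MonicCubic.natDegree_polyQ]
  have h0 : AdjoinRoot.root (MonicCubic.polyQ 2 2 2) ^ 3 + 2 * AdjoinRoot.root (MonicCubic.polyQ 2 2 2) ^ 2 +
      2 * AdjoinRoot.root (MonicCubic.polyQ 2 2 2) + 2 = 0 := by
    have h := AdjoinRoot.eval₂_root (MonicCubic.polyQ 2 2 2)
    have h' : eval₂ ((AdjoinRoot.of (MonicCubic.polyQ 2 2 2)).comp (algebraMap ℤ ℚ))
        (AdjoinRoot.root (MonicCubic.polyQ 2 2 2)) (MonicCubic.poly 2 2 2) = 0 := by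
      rw [← eval₂_map]; exact h
    simp only [MonicCubic.poly, eval₂_add, eval₂_mul, eval₂_C, eval₂_X_pow, eval₂_X] at h'
    simp only [map_ofNat] at h'
    exact h'
  refine det_form_ne_of_root (K := AdjoinRoot (MonicCubic.polyQ 2 2 2))
    (θ := AdjoinRoot.root (MonicCubic.polyQ 2 2 2)) ?_ ?_ p q r
  · rw [Polynomial.aeval_def]
    simp only [MonicCubic.poly, eval₂_add, eval₂_mul, eval₂_C, eval₂_X_pow, eval₂_X]
    simp only [map_ofNat]
    exact h0
  · convert h3

end Literature.NumberTheory.ComplexMultiplication.FiniteQAlgebraLattice.DTZCubic
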